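import Literature.AnabelianGeometry.EtaleTheta.Discharge.Sec1DecompLeKerToZ
import Literature.AnabelianGeometry.EtaleTheta.ThetaSettingCuspsSplit
import HarnessLib

/-!
# [EtTh] §1: consequences of «Hom(profinite, ℤ) = 0» for the binders of the §1 setting — sections land in
# `Π^tp_Y`, every decomposition group lies in `Π^tp_Y`, the origin clause «a cusp inside `Π^tp_Y`» and
# C15 (`CuspsSplitInYN`) lose their (P3)-type inputs

Mochizuki, *The étale theta function …*, Publ. RIMS **45** (2009), §1 p. 12–13 (`Π^tp_X ↠ Z`, `Π^tp_Y`,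
cusps of `X^log`) [cite: MochizukiEtTh2009, §1 p.13]; [SemiAnbd] §6 p. 71 (decomposition groups)
[cite: MochizukiSemiAnbd2006, §6 p.71]. Cell abc-iut, seat abc-iut-w6-d092 (gen 4); PROOF-ONLY (0 `def`),
sequel of `Sec1DecompLeKerToZ` (p444358). Nothing of the owners' files is edited; each item below REMOVES a
hypothesis binder of an existing theorem by supplying it as a theorem of the root interface:

* `ThetaSetting.toZ_apply_hom_GQp_eq_one` / `map_le_GtpY_of_hom_GQp` / `map_GK_le_GtpY_of_hom` — for ANY abstract
  homomorphism `s : G_{ℚ_p} →* Π^tp_X` (no section property, no continuity) and any `H ≤ G_{ℚ_p}`: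
  `s(H) ≤ Π^tp_Y`. This is the binder `hsY : D.GK.map s ≤ D.GtpY` of abc-iut-L2's `KummerDataOfCoreSection`,
  `KummerDataOfCoreConj`, `ThetaCohomologyCuspSectionPoints`, `Discharge/Sec1Fdd2OfSection`,
  `Sec1Prop15OfYCoordKit`, `Sec1Prop15iiOfCoreSection`, `Sec1Prop15iiiOfCoreGenerator` — now free.
* `TemperedCurve.le_ker_of_isDecompositionGroup` / `ThetaSetting.le_GtpY_of_isDecompositionGroup` /
  `le_GtpY_of_isCuspidalDecompositionGroup` — EVERY decomposition group (any closed point, any conjugate) lies in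
  `Π^tp_Y`.
* `ThetaSetting.exists_cuspidal_le_GtpY_of_exists_cusp` — the clause `IsThm16Origin.exists_cuspidal_le_GtpY`
  («`X^log` has a cusp, with a decomposition group inside `Π^tp_Y`») follows from «`X^log` has a cusp» alone.
* `ThetaSetting.cuspsSplitInYN_of_gtpYNFromCusp'` / `IsThm16Origin.cuspsSplitInYN'` — C15 from R2 WITHOUT the
  (P3) binder of abc-iut-w6-d069's `ThetaSettingCuspsSplit`.

HONEST FRAMING: elementary group theory over the typed interfaces; nothing here bears on [IUTchIII] Cor. 3.12
or takes a side; typed ≠ proved elsewhere.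
-/

open scoped Pointwise

namespace Literature.AnabelianGeometry.SemiGraphs.TemperedCurve

variable {p : ℕ} [Fact p.Prime] (X : TemperedCurve p)

/-- **Every decomposition group (any closed point, any conjugate) lies in the kernel of every abstract
homomorphism `Π^temp_{X_K} → ℤ`** (`ℤ` is commutative, so kernels are normal). [cite: MochizukiSemiAnbd2006, §6 p.71] -/
theorem le_ker_of_isDecompositionGroup (φ : X.PiTemp →* Multiplicative ℤ) {Dc : Subgroup X.PiTemp}
    (h : X.IsDecompositionGroup Dc) : Dc ≤ φ.ker := by
  obtain ⟨x, γ, rfl⟩ := h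
  intro d hd
  rw [Subgroup.mem_pointwise_smul_iff_inv_smul_mem] at hd
  have h1 := X.decomp_le_ker_of_hom_int φ x hd
  rw [MonoidHom.mem_ker, ConjAct.smul_def, map_mul, map_mul, ConjAct.ofConjAct_inv, map_inv, mul_comm,
    ← mul_assoc, inv_inv, mul_inv_cancel, one_mul] at h1
  exact h1

/-- The cuspidal case of `le_ker_of_isDecompositionGroup`. [cite: MochizukiSemiAnbd2006, §6 p.71] -/
theorem le_ker_of_isCuspidalDecompositionGroup (φ : X.PiTemp →* Multiplicative ℤ) {Dc : Subgroup X.PiTemp}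
    (h : X.IsCuspidalDecompositionGroup Dc) : Dc ≤ φ.ker := by
  obtain ⟨x, -, γ, rfl⟩ := h
  exact X.le_ker_of_isDecompositionGroup φ ⟨x, γ, rfl⟩

/-- **Images of `G_{ℚ_p}` die in `ℤ`**: for ANY abstract homomorphism `s : G_{ℚ_p} →* Π^temp_{X_K}` and any
`φ : Π^temp_{X_K} →* ℤ`, `φ ∘ s = 1` — `G_{ℚ_p}` is profinite. [cite: MochizukiSemiAnbd2006, §6 p.69] -/
theorem apply_hom_GQp_eq_one (φ : X.PiTemp →* Multiplicative ℤ) (s : GQp p →* X.PiTemp) (σ : GQp p) :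
    φ (s σ) = 1 := by
  haveI : CompactSpace (GQp p) :=
    inferInstanceAs (CompactSpace (AlgebraicClosure ℚ_[p] ≃ₐ[ℚ_[p]] AlgebraicClosure ℚ_[p]))
  haveI : TotallyDisconnectedSpace (GQp p) :=
    inferInstanceAs (TotallyDisconnectedSpace (AlgebraicClosure ℚ_[p] ≃ₐ[ℚ_[p]] AlgebraicClosure ℚ_[p]))
  exact Literature.AnabelianGeometry.EtaleTheta.monoidHom_apply_eq_one_of_compactSpace_of_totallyDisconnectedSpace
    (φ.comp s) σ

end Literature.AnabelianGeometry.SemiGraphs.TemperedCurve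

namespace Literature.AnabelianGeometry.EtaleTheta.ThetaSetting

open Literature.AnabelianGeometry.SemiGraphs

variable {p : ℕ} [Fact p.Prime] (D : ThetaSetting p)

/-- `toZ ∘ s = 1` for every abstract homomorphism `s : G_{ℚ_p} →* Π^tp_X`. [cite: MochizukiEtTh2009, §1 p.13] -/
theorem toZ_apply_hom_GQp_eq_one (s : GQp p →* D.PiTemp) (σ : GQp p) : D.toZ (s σ) = 1 :=
  D.toTemperedCurve.apply_hom_GQp_eq_one D.toZ s σ

/-- **`s(H) ≤ Π^tp_Y`** for every abstract `s : G_{ℚ_p} →* Π^tp_X` and every `H ≤ G_{ℚ_p}`.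
[cite: MochizukiEtTh2009, §1 p.13] -/
theorem map_le_GtpY_of_hom_GQp (s : GQp p →* D.PiTemp) (H : Subgroup (GQp p)) : H.map s ≤ D.GtpY := by
  rintro _ ⟨σ, -, rfl⟩
  exact D.toZ_apply_hom_GQp_eq_one s σ

/-- **The binder `hsY : D.GK.map s ≤ D.GtpY`** (`KummerDataOfCoreSection` &c.) holds for EVERY
`s : G_{ℚ_p} →* Π^tp_X` — no section property, no continuity. [cite: MochizukiEtTh2009, §1 p.13] -/
theorem map_GK_le_GtpY_of_hom (s : GQp p →* D.PiTemp) : D.GK.map s ≤ D.GtpY :=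
  D.map_le_GtpY_of_hom_GQp s D.GK

/-- Every decomposition group of `Π^tp_X` (any closed point, any conjugate) lies in `Π^tp_Y`.
[cite: MochizukiEtTh2009, §1 p.13] -/
theorem le_GtpY_of_isDecompositionGroup {Dc : Subgroup D.PiTemp} (h : D.IsDecompositionGroup Dc) :
    Dc ≤ D.GtpY :=
  D.toTemperedCurve.le_ker_of_isDecompositionGroup D.toZ h

/-- Every CUSPIDAL decomposition group lies in `Π^tp_Y` (p. 13: cusps of `X^log` sit over the single
vertex of the dual graph). [cite: MochizukiEtTh2009, §1 p.13] -/
theorem le_GtpY_of_isCuspidalDecompositionGroup {Dc : Subgroup D.PiTemp}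
    (h : D.IsCuspidalDecompositionGroup Dc) : Dc ≤ D.GtpY :=
  D.toTemperedCurve.le_ker_of_isCuspidalDecompositionGroup D.toZ h

/-- **The origin clause `IsThm16Origin.exists_cuspidal_le_GtpY` from «`X^log` has a cusp» alone.**
[cite: MochizukiEtTh2009, §1 p.12] -/
theorem exists_cuspidal_le_GtpY_of_exists_cusp (h : ∃ x : D.Pt, D.IsCusp x) :
    ∃ Dc : Subgroup D.PiTemp, D.IsCuspidalDecompositionGroup Dc ∧ Dc ≤ D.GtpY := by
  obtain ⟨x, hx⟩ := h
  exact ⟨D.decomp x, ⟨x, hx, 1, (one_smul _ _).symm⟩, D.decomp_le_ker_toZ_of_root x⟩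

/-- **R2 ⇒ C15 without (P3)**: `Thm16Sub.GtpYNFromCusp D N` for every `N` already gives
`CuspsSplitInYN D` (abc-iut-w6-d069's `cuspsSplitInYN_of_gtpYNFromCusp` with its binder `hP3` supplied by
`decomp_le_ker_toZ_of_root`). [cite: MochizukiEtTh2009, §1 p.13] -/
theorem cuspsSplitInYN_of_gtpYNFromCusp' (hR2 : ∀ N : ℕ+, Thm16Sub.GtpYNFromCusp D N) :
    D.CuspsSplitInYN :=
  D.cuspsSplitInYN_of_gtpYNFromCusp hR2 fun x _ => D.decomp_le_ker_toZ_of_root x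

/-- `IsThm16Origin D → CuspsSplitInYN D`, (P3)-free. [cite: MochizukiEtTh2009, §1 p.13] -/
theorem IsThm16Origin.cuspsSplitInYN' (h : D.IsThm16Origin) : D.CuspsSplitInYN :=
  D.cuspsSplitInYN_of_gtpYNFromCusp' h.gtpYN_fromCusp

end Literature.AnabelianGeometry.EtaleTheta.ThetaSetting
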